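import Literature.Analysis.FluidPDE.MildL3Smooth
import Literature.Analysis.FluidPDE.KatoSymmetryCovariance
import Literature.Analysis.UnboundedOperators.HeatKernelBoundedData
import Literature.Analysis.FluidPDE.MildSolutionProofs
import HarnessLib

/-!
# The restart (two-time) identity for `C([0,T); L³)` mild solutions by heat-kernel averaging: discharge of `mild_L3_restart`

Analysis/FluidPDE proof file discharging the named fact
`Literature.Analysis.FluidPDE.mild_L3_restart` (`MildL3Smooth.lean`; Fabes–Jones–Rivière 1972,
Thm. 2.1; Lemarié-Rieusset 2016, Thm. 6.1 with Prop. 6.5): an unforced mild solution `v` of the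
Navier–Stokes equations on `[0, T)` in the tree's duality (very weak) form
`Fluid.IsMildNSSolutionOn (Ico 0 T) ν 0 u₀ v`, with `u₀ ∈ L³`, `v ∈ C([0,T); L³)` and `v` jointly
measurable, satisfies the two-time identity `Fluid.IsMildNSSolutionBetween ν 0 v s t` for all
`0 ≤ s ≤ t < T`:
`∫⟪v(t), φ⟫ = ∫⟪v(s), e^{ν(t-s)Δ}φ⟫ + ∫ₛᵗ ∫⟪v(τ), (v(τ)·∇) e^{ν(t-τ)Δ}φ⟫ dτ`.

## The proof (averaging translated tests against the heat kernel)

The identity from the datum at time `s` is only available for *compactly supported*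
divergence-free tests, while the two-time identity needs it for the caloric test
`ψ = e^{ν(t-s)Δ}φ`, which is not compactly supported. Instead of a solenoidal truncation we use
that `ψ = K ⋆ φ = ∫ K(y) φ(· - y) dy` (`K` the heat kernel at time `a = ν(t-s)`) is an *average of
translates* of `φ`, each of which is an admissible test. Multiplying the identity at time `s`
for the test `φ(· - y)` by `K(y)` and integrating in `y` gives, by Fubini (the three averaging
lemmas of this file) and the semigroup law,
`∫⟪v(s), e^{aΔ}φ⟫ = ∫⟪u₀, e^{νtΔ}φ⟫ + ∫₀ˢ ∫⟪v(τ), (v(τ)·∇) e^{ν(t-τ)Δ}φ⟫ dτ`;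
subtracting this from the identity at time `t` (whose nonlinear term is interval-integrable on
`[0, t]`, `intervalIntegrable_transportPairing`) yields the two-time identity. The argument is
dimension free; the fact itself is stated on `ℝ³`. (The tree's `MildL3Restart.lean` proves the
three-dimensional case `IsMildNSSolutionOn.isMildNSSolutionBetween_of_continuousInLpOn_three` by a
different route — solenoidal truncation of the caloric test field, which uses `dim E = 3`; the
averaging argument here needs no truncation and no dimension hypothesis.)

* `integral_heatKernel_mul_integral_inner_comp_sub`: `∫ K(y) (∫⟪g, ψ(· - y)⟫) dy = ∫⟪g, e^{aΔ}ψ⟫`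
  for `g ∈ Lᵖ`, `ψ ∈ L^q`, `1/p + 1/q = 1` (Fubini under Hölder and Young);
* `fderiv_heatTest_eq_heatTest_fderiv`: `D(e^{νσΔ}φ) = e^{νσΔ}(Dφ)` for all `σ` (`C¹_c` data;
  the tree's `fderiv_heatFlow` as an identity of functions);
* `integrable_transportIntegrand_Ioo`: joint integrability on `(0,s) × E` of the transport
  integrand `⟪v, D(e^{ν(s-τ)Δ}θ) v⟫` with the bound `s M² ‖Dθ‖₃`;
* `integral_heatKernel_mul_transport`: the averaged nonlinear term;
* `IsMildNSSolutionOn.isMildNSSolutionBetween_of_continuousInLpOn` (any dimension) and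
  `mild_L3_restart_holds`.

## References

* E. B. Fabes, B. F. Jones, N. M. Rivière, *The initial value problem for the Navier–Stokes
  equations with data in `L^p`*, Arch. Rational Mech. Anal. 45 (1972) 222–240, Thm. 2.1.
  [FabesJonesRiviere1972]
* P. G. Lemarié-Rieusset, *The Navier–Stokes Problem in the 21st Century*, CRC Press 2016,
  doi:10.1201/b19556, Thm. 6.1 and Prop. 6.5 (PDF pp. 134–136), proof of Thm. 9.11
  (PDF p. 256: the restarted solution). [LemarieRieusset2016]
* T. Kato, Math. Z. 187 (1984), (1.7). [Kato1984]
-/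

noncomputable section

open MeasureTheory TopologicalSpace Set Function Filter InnerProductSpace
open _root_.Topology
open scoped RealInnerProductSpace ENNReal NNReal Convolution

namespace Literature.Analysis.FluidPDE

variable {E : Type*} [NormedAddCommGroup E] [InnerProductSpace ℝ E] [FiniteDimensional ℝ E]
  [MeasurableSpace E] [BorelSpace E]

/-! ### Averaging a pairing against the heat kernel -/

section Averaging

variable {F : Type*} [NormedAddCommGroup F] [InnerProductSpace ℝ F] [CompleteSpace F]

/-- **Averaging translated pairings against the heat kernel.** For `g ∈ Lᵖ(E; F)`,
`ψ ∈ L^q(E; F)` with `1/p + 1/q = 1` and `a > 0`,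
`∫ K_a(y) (∫ ⟪g(x), ψ(x - y)⟫ dx) dy = ∫ ⟪g(x), (e^{aΔ}ψ)(x)⟫ dx`, `K_a` the heat kernel: Fubini on
`E × E`, the integrand `K_a(y)⟪g(x), ψ(x-y)⟫` being integrable since
`∫∫ K_a(y) ‖g(x)‖ ‖ψ(x-y)‖ = ∫ ‖g‖ (K_a ⋆ ‖ψ‖) ≤ ‖g‖_p ‖ψ‖_q` (Young and Hölder). [folklore] -/
theorem integral_heatKernel_mul_integral_inner_comp_sub {p q : ℝ≥0∞} [hpq : p.HolderConjugate q]
    {g ψ : E → F} (hg : MemLp g p volume) (hψ : MemLp ψ q volume) {a : ℝ} (ha : 0 < a) :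
    Integrable (fun y => UnboundedOperators.heatKernel a y * (∫ x, ⟪g x, ψ (x - y)⟫)) volume ∧
      ∫ y, UnboundedOperators.heatKernel a y * (∫ x, ⟪g x, ψ (x - y)⟫) =
        ∫ x, ⟪g x, UnboundedOperators.heatExtension ψ a x⟫ := by
  set K : E → ℝ := UnboundedOperators.heatKernel a with hK
  have hp1 : 1 ≤ p := ENNReal.HolderConjugate.one_le p q
  have hq1 : 1 ≤ q := ENNReal.HolderConjugate.one_le q p
  have hKi : Integrable K volume := UnboundedOperators.integrable_heatKernel_holds ha
  have hKp : MemLp K p volume := UnboundedOperators.memLp_heatKernel ha hp1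
  -- the integrand on `E × E`, `x` outer
  set f : E → E → ℝ := fun x y => K y * ⟪g x, ψ (x - y)⟫ with hf
  -- `y ↦ K y • ψ (x - y)` is integrable for every `x` (Hölder)
  have hconv : ∀ x, Integrable (fun y => K y • ψ (x - y)) volume := fun x =>
    UnboundedOperators.convolutionExistsAt_of_memLp (ContinuousLinearMap.lsmul ℝ ℝ) hKp hψ x
  -- measurability on the product
  have hfm : AEStronglyMeasurable (uncurry f) ((volume : Measure E).prod volume) := by
    have h1 : AEStronglyMeasurable (fun z : E × E => K z.2) ((volume : Measure E).prod volume) :=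
      ((UnboundedOperators.continuous_heatKernel a).comp continuous_snd).aestronglyMeasurable
    have h2 : AEStronglyMeasurable (fun z : E × E => g z.1) ((volume : Measure E).prod volume) :=
      hg.1.comp_fst
    have h3 : AEStronglyMeasurable (fun z : E × E => ψ (z.1 - z.2))
        ((volume : Measure E).prod volume) :=
      hψ.1.comp_quasiMeasurePreserving (quasiMeasurePreserving_sub volume volume)
    exact h1.mul (h2.inner h3)
  -- integrability on the product
  have hfi : Integrable (uncurry f) ((volume : Measure E).prod volume) := by
    rw [integrable_prod_iff hfm]
    refine ⟨Eventually.of_forall fun x => ?_, ?_⟩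
    · have h := (hconv x).norm.const_mul ‖g x‖
      have hψx : AEStronglyMeasurable (fun y => ψ (x - y)) volume :=
        hψ.1.comp_quasiMeasurePreserving (quasiMeasurePreserving_sub_left volume x)
      refine h.mono' ?_ (Eventually.of_forall fun y => ?_)
      · exact (UnboundedOperators.continuous_heatKernel a).aestronglyMeasurable.mul
          ((aestronglyMeasurable_const (b := g x)).inner hψx)
      · simp only [hf, uncurry_apply_pair, norm_mul, norm_smul]
        calc ‖K y‖ * ‖⟪g x, ψ (x - y)⟫‖ ≤ ‖K y‖ * (‖g x‖ * ‖ψ (x - y)‖) := by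
              gcongr; exact norm_inner_le_norm _ _
          _ = ‖g x‖ * (‖K y‖ * ‖ψ (x - y)‖) := by ring
    · -- `x ↦ ∫ ‖f x y‖ dy ≤ ‖g x‖ (K ⋆ ‖ψ‖)(x)`, an `Lᵖ × L^q` product
      have hN : MemLp (UnboundedOperators.heatExtension (fun z => ‖ψ z‖) a) q volume :=
        UnboundedOperators.memLp_heatExtension_holds hψ.norm hq1 ha
      have hprod : Integrable
          (fun x => ‖g x‖ * UnboundedOperators.heatExtension (fun z => ‖ψ z‖) a x) volume :=
        hg.norm.integrable_mul hN
      refine hprod.mono' hfm.norm.integral_prod_right' (Eventually.of_forall fun x => ?_)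
      rw [Real.norm_of_nonneg (integral_nonneg fun _ => norm_nonneg _)]
      have hK0 : ∀ y, 0 ≤ K y := fun y => (UnboundedOperators.heatKernel_pos ha y).le
      have hb : ∀ y, ‖uncurry f (x, y)‖ ≤ ‖g x‖ * (K y * ‖ψ (x - y)‖) := fun y => by
        simp only [hf, uncurry_apply_pair, norm_mul, Real.norm_of_nonneg (hK0 y)]
        calc K y * ‖⟪g x, ψ (x - y)⟫‖ ≤ K y * (‖g x‖ * ‖ψ (x - y)‖) :=
              mul_le_mul_of_nonneg_left (norm_inner_le_norm _ _) (hK0 y)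
          _ = ‖g x‖ * (K y * ‖ψ (x - y)‖) := by ring
      have hint2 : Integrable (fun y => ‖g x‖ * (K y * ‖ψ (x - y)‖)) volume := by
        refine ((hconv x).norm.const_mul ‖g x‖).congr (Eventually.of_forall fun y => ?_)
        simp only [norm_smul, Real.norm_of_nonneg (hK0 y)]
      calc ∫ y, ‖uncurry f (x, y)‖ ≤ ∫ y, ‖g x‖ * (K y * ‖ψ (x - y)‖) :=
            integral_mono_of_nonneg (Eventually.of_forall fun _ => norm_nonneg _) hint2
              (Eventually.of_forall hb)
        _ = ‖g x‖ * UnboundedOperators.heatExtension (fun z => ‖ψ z‖) a x := by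
            rw [integral_const_mul, UnboundedOperators.heatExtension_apply]
            rfl
  -- Fubini
  have hy : ∀ y, K y * (∫ x, ⟪g x, ψ (x - y)⟫) = ∫ x, f x y := fun y => by
    simp only [hf, ← integral_const_mul]
  refine ⟨hfi.integral_prod_right.congr (Eventually.of_forall fun y => (hy y).symm), ?_⟩
  calc ∫ y, K y * (∫ x, ⟪g x, ψ (x - y)⟫)
      = ∫ y, ∫ x, f x y := integral_congr_ae (Eventually.of_forall hy)
    _ = ∫ x, ∫ y, f x y := (integral_integral_swap hfi).symm
    _ = ∫ x, ⟪g x, UnboundedOperators.heatExtension ψ a x⟫ := by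
        refine integral_congr_ae (Eventually.of_forall fun x => ?_)
        simp only [hf]
        rw [UnboundedOperators.heatExtension_apply, ← integral_inner (hconv x) (g x)]
        refine integral_congr_ae (Eventually.of_forall fun y => ?_)
        simp only [real_inner_smul_right]

end Averaging


/-! ### The caloric test field and its gradient -/

section HeatTestTools

variable {F' : Type*} [NormedAddCommGroup F'] [NormedSpace ℝ F'] [CompleteSpace F']
variable {ν : ℝ}

omit [CompleteSpace F'] in
/-- **The derivative of the caloric test field is the caloric flow of the derivative**, for every
elapsed time: `D(e^{νσΔ}φ) = e^{νσΔ}(Dφ)` for `φ ∈ C¹_c` and all `σ` (the tree's `fderiv_heatFlow`,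
as an identity of functions). [folklore] -/
theorem fderiv_heatTest_eq_heatTest_fderiv {φ : E → F'} (hφ : ContDiff ℝ 1 φ)
    (hc : HasCompactSupport φ) (ν σ : ℝ) :
    fderiv ℝ (heatTest ν φ σ) = heatTest ν (fderiv ℝ φ) σ :=
  funext fun x => fderiv_heatFlow hφ hc (ν * σ) x

/-- **Semigroup law across the caloric test field**: `e^{νbΔ}(e^{νσΔ}g) = e^{ν(σ + b)Δ}g`, in the
form `heatExtension (heatTest ν g σ) (ν * b) = heatTest ν g (σ + b)` for `σ ≥ 0`, `b > 0` and
`g ∈ Lᵖ` (`heatFlow_heatFlow_holds`). [folklore] -/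
theorem heatExtension_heatTest_eq {g : E → F'} {p : ℝ≥0∞} (hg : MemLp g p volume) (hp : 1 ≤ p)
    (hν : 0 < ν) {σ b : ℝ} (hσ : 0 ≤ σ) (hb : 0 < b) :
    UnboundedOperators.heatExtension (heatTest ν g σ) (ν * b) = heatTest ν g (σ + b) := by
  have hνb : 0 < ν * b := mul_pos hν hb
  have h := heatFlow_heatFlow_holds hg hp (mul_nonneg hν.le hσ) hνb.le
  rw [heatFlow_of_pos _ hνb] at h
  simp only [heatTest]
  rw [h, mul_add]

end HeatTestTools

/-! ### The transport integrand on a slab -/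

section Transport

variable {ν : ℝ}

/-- **Joint integrability of the transport integrand on the slab `(0, s) × E`.** For a `C¹_c`
field `θ`, `v` jointly measurable on `(0, T) × E` and bounded by `M` in `L³` on `[0, s]`,
`s ≤ T`, the integrand `(τ, x) ↦ ⟪v(τ,x), D(e^{ν(s-τ)Δ}θ)(x) v(τ,x)⟫` is integrable on
`(0, s) × E` with `L¹` norm at most `s M² ‖Dθ‖_{L³}` (three-factor Hölder at fixed `τ`, the `L³`
contraction `‖D(e^{νσΔ}θ)‖₃ ≤ ‖Dθ‖₃`, and Fubini). [folklore] -/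
theorem integrable_transportIntegrand_Ioo (hν : 0 < ν) {θ : E → E} (hθ : ContDiff ℝ 1 θ)
    (hc : HasCompactSupport θ) {v : ℝ → E → E} {s T : ℝ} (hs : 0 ≤ s) (hsT : s ≤ T)
    (hmeas : AEStronglyMeasurable (uncurry v)
      ((volume : Measure (ℝ × E)).restrict (Ioo 0 T ×ˢ univ)))
    {M : ℝ≥0} (hv3 : ∀ τ ∈ Icc 0 s, MemLp (v τ) 3 volume ∧ eLpNorm (v τ) 3 volume ≤ M) :
    Integrable (fun q : ℝ × E => ⟪v q.1 q.2, fderiv ℝ (heatTest ν θ (s - q.1)) q.2 (v q.1 q.2)⟫)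
        ((volume.restrict (Ioo 0 s)).prod (volume : Measure E)) ∧
      ∫ q, ‖⟪v q.1 q.2, fderiv ℝ (heatTest ν θ (s - q.1)) q.2 (v q.1 q.2)⟫‖
          ∂((volume.restrict (Ioo 0 s)).prod (volume : Measure E)) ≤
        s * ((M : ℝ) ^ 2 * (eLpNorm (fderiv ℝ θ) 3 volume).toReal) := by
  haveI : IsFiniteMeasure (volume.restrict (Ioo (0 : ℝ) s)) :=
    isFiniteMeasure_restrict.2 measure_Ioo_lt_top.ne
  have hDθ : MemLp (fderiv ℝ θ) 3 (volume : Measure E) :=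
    (hθ.continuous_fderiv one_ne_zero).memLp_of_hasCompactSupport (hc.fderiv ℝ)
  -- measurability on the slab (the kernel is continuous on `τ < s`)
  have hv' : AEStronglyMeasurable (uncurry v) ((volume.restrict (Ioo 0 s)).prod (volume : Measure E)) :=
    aestronglyMeasurable_uncurry_mono hsT hmeas
  have hΨc : ContinuousOn (fun q : ℝ × E => fderiv ℝ (heatTest ν θ (s - q.1)) q.2)
      (Iio s ×ˢ univ) := by
    have hc2 : Continuous fun q : ℝ × E => ((s - q.1, q.2) : ℝ × E) := by fun_prop
    have h := ContinuousOn.comp (g := fun q : ℝ × E => fderiv ℝ (heatTest ν θ q.1) q.2)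
      (f := fun q : ℝ × E => ((s - q.1, q.2) : ℝ × E)) (s := Iio s ×ˢ univ)
      (continuousOn_fderiv_heatTest hν hθ hc) hc2.continuousOn
      (fun q hq => ⟨show (0 : ℝ) < s - q.1 from sub_pos.2 hq.1, mem_univ _⟩)
    simpa only [Function.comp_def] using h
  have hΨm : AEStronglyMeasurable (fun q : ℝ × E => fderiv ℝ (heatTest ν θ (s - q.1)) q.2)
      ((volume.restrict (Ioo 0 s)).prod (volume : Measure E)) := by
    have h := (hΨc.mono (prod_mono (Ioo_subset_Iio_self (a := (0 : ℝ)))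
      (subset_univ _))).aestronglyMeasurable
      (μ := (volume : Measure (ℝ × E))) (measurableSet_Ioo.prod MeasurableSet.univ)
    rwa [volume_restrict_slab_eq_prod] at h
  have happ := (isBoundedBilinearMap_apply (𝕜 := ℝ) (E := E) (F := E)).continuous
  have hH : AEStronglyMeasurable
      (fun q : ℝ × E => ⟪v q.1 q.2, fderiv ℝ (heatTest ν θ (s - q.1)) q.2 (v q.1 q.2)⟫)
      ((volume.restrict (Ioo 0 s)).prod (volume : Measure E)) :=
    hv'.inner (happ.comp_aestronglyMeasurable (hΨm.prodMk hv'))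
  -- `x`-sections
  set C : ℝ := ((M : ℝ≥0∞) * eLpNorm (fderiv ℝ θ) 3 volume * M).toReal with hC
  have hCeq : C = (M : ℝ) ^ 2 * (eLpNorm (fderiv ℝ θ) 3 volume).toReal := by
    rw [hC, ENNReal.toReal_mul, ENNReal.toReal_mul, ENNReal.coe_toReal]
    ring
  have hsec : ∀ τ ∈ Icc 0 s,
      Integrable (fun x => ⟪v τ x, fderiv ℝ (heatTest ν θ (s - τ)) x (v τ x)⟫) volume ∧
        ∫ x, ‖⟪v τ x, fderiv ℝ (heatTest ν θ (s - τ)) x (v τ x)⟫‖ ≤ C := by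
    intro τ hτ
    have hστ : 0 ≤ s - τ := sub_nonneg.2 hτ.2
    have hΨ : MemLp (fderiv ℝ (heatTest ν θ (s - τ))) 3 (volume : Measure E) :=
      memLp_fderiv_heatTest hν hστ hθ hc (by norm_num)
    refine ⟨(integral_inner_clm_apply_le (hv3 τ hτ).1 (hv3 τ hτ).1 hΨ).1, ?_⟩
    refine (integral_norm_inner_clm_apply_le (hv3 τ hτ).1 (hv3 τ hτ).1 hΨ).trans ?_
    have hfin : (M : ℝ≥0∞) * eLpNorm (fderiv ℝ θ) 3 volume * M ≠ ⊤ :=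
      ENNReal.mul_ne_top (ENNReal.mul_ne_top ENNReal.coe_ne_top hDθ.2.ne) ENNReal.coe_ne_top
    refine ENNReal.toReal_mono hfin ?_
    gcongr
    · exact (hv3 τ hτ).2
    · exact eLpNorm_fderiv_heatTest_le hν hστ hθ hc (by norm_num)
    · exact (hv3 τ hτ).2
  have hint : Integrable
      (fun q : ℝ × E => ⟪v q.1 q.2, fderiv ℝ (heatTest ν θ (s - q.1)) q.2 (v q.1 q.2)⟫)
      ((volume.restrict (Ioo 0 s)).prod (volume : Measure E)) := by
    rw [integrable_prod_iff hH]
    constructor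
    · refine (ae_restrict_iff' measurableSet_Ioo).2 (Eventually.of_forall fun τ hτ => ?_)
      exact (hsec τ ⟨hτ.1.le, hτ.2.le⟩).1
    · refine Integrable.mono' (integrable_const C) hH.norm.integral_prod_right' ?_
      refine (ae_restrict_iff' measurableSet_Ioo).2 (Eventually.of_forall fun τ hτ => ?_)
      rw [Real.norm_of_nonneg (integral_nonneg fun _ => norm_nonneg _)]
      exact (hsec τ ⟨hτ.1.le, hτ.2.le⟩).2
  refine ⟨hint, ?_⟩
  rw [integral_prod _ hint.norm]
  calc ∫ τ in Ioo 0 s, ∫ x, ‖⟪v τ x, fderiv ℝ (heatTest ν θ (s - τ)) x (v τ x)⟫‖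
      ≤ ∫ τ in Ioo 0 s, C := by
        refine setIntegral_mono_on hint.norm.integral_prod_left
          (integrableOn_const measure_Ioo_lt_top.ne) measurableSet_Ioo fun τ hτ => ?_
        exact (hsec τ ⟨hτ.1.le, hτ.2.le⟩).2
    _ = s * ((M : ℝ) ^ 2 * (eLpNorm (fderiv ℝ θ) 3 volume).toReal) := by
        rw [setIntegral_const, Real.volume_real_Ioo_of_le hs, smul_eq_mul, sub_zero, hCeq]

/-- **Averaging the nonlinear term against the heat kernel.** In the setting of
`integrable_transportIntegrand_Ioo` (with `θ = φ ∈ C¹_c`, `0 ≤ s ≤ T`) and for `a > 0`,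
`∫ K_a(y) (∫₀ˢ ∫ ⟪v, D(e^{ν(s-τ)Δ}φ)(· - y) v⟫ dτ) dy = ∫₀ˢ ∫ ⟪v, (e^{aΔ} D(e^{ν(s-τ)Δ}φ)) v⟫ dτ`,
the `y`-integrand being integrable: Fubini on `E × ((0,s) × E)`; for each `y` the inner integrand
is the transport integrand of the translated test `φ(· - y)`, with `L¹` norm at most
`s M² ‖Dφ‖₃` uniformly in `y`, and the kernel `y ↦ K_a(y) D(e^{ν(s-τ)Δ}φ)(x - y)` is integrable
with integral `(e^{aΔ} D(e^{ν(s-τ)Δ}φ))(x)`. [folklore] -/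
theorem integral_heatKernel_mul_transport (hν : 0 < ν) {φ : E → E} (hφ : ContDiff ℝ 1 φ)
    (hc : HasCompactSupport φ) {v : ℝ → E → E} {s T : ℝ} (hs : 0 ≤ s) (hsT : s ≤ T)
    (hmeas : AEStronglyMeasurable (uncurry v)
      ((volume : Measure (ℝ × E)).restrict (Ioo 0 T ×ˢ univ)))
    {M : ℝ≥0} (hv3 : ∀ τ ∈ Icc 0 s, MemLp (v τ) 3 volume ∧ eLpNorm (v τ) 3 volume ≤ M)
    {a : ℝ} (ha : 0 < a) :
    Integrable (fun y => UnboundedOperators.heatKernel a y *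
        (∫ τ in 0..s, ∫ x, ⟪v τ x, fderiv ℝ (heatTest ν φ (s - τ)) (x - y) (v τ x)⟫)) volume ∧
      ∫ y, UnboundedOperators.heatKernel a y *
          (∫ τ in 0..s, ∫ x, ⟪v τ x, fderiv ℝ (heatTest ν φ (s - τ)) (x - y) (v τ x)⟫) =
        ∫ τ in 0..s, ∫ x, ⟪v τ x,
          UnboundedOperators.heatExtension (fderiv ℝ (heatTest ν φ (s - τ))) a x (v τ x)⟫ := by
  set K : E → ℝ := UnboundedOperators.heatKernel a with hK
  set μ : Measure (ℝ × E) := (volume.restrict (Ioo 0 s)).prod (volume : Measure E) with hμ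
  haveI : IsFiniteMeasure (volume.restrict (Ioo (0 : ℝ) s)) :=
    isFiniteMeasure_restrict.2 measure_Ioo_lt_top.ne
  have hKi : Integrable K volume := UnboundedOperators.integrable_heatKernel_holds ha
  have hK0 : ∀ y, 0 ≤ K y := fun y => (UnboundedOperators.heatKernel_pos ha y).le
  have happ := (isBoundedBilinearMap_apply (𝕜 := ℝ) (E := E) (F := E)).continuous
  -- the kernels `D(e^{νσΔ}φ) = e^{νσΔ}(Dφ)` are continuous and bounded by `‖Dφ‖_∞`
  have hDφc : Continuous (fderiv ℝ φ) := hφ.continuous_fderiv one_ne_zero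
  have hDφs : HasCompactSupport (fderiv ℝ φ) := hc.fderiv ℝ
  obtain ⟨D₀, hD₀⟩ := hDφc.bounded_above_of_compact_support hDφs
  have hΨcont : ∀ σ, Continuous (fderiv ℝ (heatTest ν φ σ)) := fun σ => by
    rw [fderiv_heatTest_eq_heatTest_fderiv hφ hc ν σ]
    exact (contDiff_heatFlow (contDiff_zero.2 hDφc) hDφs _).continuous
  have hΨbd : ∀ σ z, ‖fderiv ℝ (heatTest ν φ σ) z‖ ≤ D₀ := fun σ z => by
    rw [fderiv_heatTest_eq_heatTest_fderiv hφ hc ν σ]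
    exact norm_heatFlow_le hD₀ _ z
  -- translated tests
  have htr : ∀ (y : E) (τ : ℝ) (x : E), fderiv ℝ (heatTest ν φ (s - τ)) (x - y) =
      fderiv ℝ (heatTest ν (fun z => φ (z + -y)) (s - τ)) x := by
    intro y τ x
    have h1 : heatTest ν (fun z => φ (z + -y)) (s - τ) = fun z => heatTest ν φ (s - τ) (z + -y) :=
      funext fun z => heatTest_comp_add_right ν φ (-y) (s - τ) z
    rw [h1, fderiv_comp_add_right, ← sub_eq_add_neg]
  -- slab integrability for every translate, with a uniform bound
  set B : ℝ := s * ((M : ℝ) ^ 2 * (eLpNorm (fderiv ℝ φ) 3 volume).toReal) with hB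
  have hT : ∀ y : E, Integrable (fun q : ℝ × E =>
        ⟪v q.1 q.2, fderiv ℝ (heatTest ν φ (s - q.1)) (q.2 - y) (v q.1 q.2)⟫) μ ∧
      ∫ q, ‖⟪v q.1 q.2, fderiv ℝ (heatTest ν φ (s - q.1)) (q.2 - y) (v q.1 q.2)⟫‖ ∂μ ≤ B := by
    intro y
    have hφy : ContDiff ℝ 1 (fun z => φ (z + -y)) := hφ.comp (contDiff_id.add contDiff_const)
    have hcy : HasCompactSupport (fun z => φ (z + -y)) :=
      hc.comp_homeomorph (Homeomorph.addRight (-y))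
    have h := integrable_transportIntegrand_Ioo hν hφy hcy hs hsT hmeas hv3
    have hnorm : eLpNorm (fderiv ℝ (fun z => φ (z + -y))) 3 volume =
        eLpNorm (fderiv ℝ φ) 3 (volume : Measure E) := by
      have hD : fderiv ℝ (fun z => φ (z + -y)) = fun z => fderiv ℝ φ (z + -y) :=
        funext fun z => fderiv_comp_add_right (-y)
      rw [hD]
      exact eLpNorm_comp_measurePreserving (p := 3) hDφc.aestronglyMeasurable
        (measurePreserving_add_right volume (-y))
    simp only [← htr y] at h
    rw [hnorm] at h
    exact h
  -- the integrand on `E × ((0,s) × E)`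
  set H : E × (ℝ × E) → ℝ := fun z =>
    K z.1 * ⟪v z.2.1 z.2.2, fderiv ℝ (heatTest ν φ (s - z.2.1)) (z.2.2 - z.1) (v z.2.1 z.2.2)⟫ with hH
  have hHm : AEStronglyMeasurable H ((volume : Measure E).prod μ) := by
    have h1 : AEStronglyMeasurable (fun z : E × (ℝ × E) => K z.1) ((volume : Measure E).prod μ) :=
      ((UnboundedOperators.continuous_heatKernel a).comp continuous_fst).aestronglyMeasurable
    have hv' : AEStronglyMeasurable (uncurry v) μ := aestronglyMeasurable_uncurry_mono hsT hmeas
    have h2 : AEStronglyMeasurable (fun z : E × (ℝ × E) => v z.2.1 z.2.2)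
        ((volume : Measure E).prod μ) := hv'.comp_snd
    have h3 : AEStronglyMeasurable
        (fun z : E × (ℝ × E) => fderiv ℝ (heatTest ν φ (s - z.2.1)) (z.2.2 - z.1))
        ((volume : Measure E).prod μ) := by
      have hcont : ContinuousOn
          (fun z : E × (ℝ × E) => fderiv ℝ (heatTest ν φ (s - z.2.1)) (z.2.2 - z.1))
          (univ ×ˢ (Iio s ×ˢ univ)) := by
        have hc2 : Continuous fun z : E × (ℝ × E) => ((s - z.2.1, z.2.2 - z.1) : ℝ × E) := by
          fun_prop
        have h := ContinuousOn.comp (g := fun q : ℝ × E => fderiv ℝ (heatTest ν φ q.1) q.2)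
          (f := fun z : E × (ℝ × E) => ((s - z.2.1, z.2.2 - z.1) : ℝ × E))
          (s := univ ×ˢ (Iio s ×ˢ univ)) (continuousOn_fderiv_heatTest hν hφ hc)
          hc2.continuousOn
          (fun z hz => ⟨show (0 : ℝ) < s - z.2.1 from
            sub_pos.2 (mem_prod.1 (mem_prod.1 hz).2).1, mem_univ _⟩)
        simpa only [Function.comp_def] using h
      have h := (hcont.mono (prod_mono subset_rfl (prod_mono (Ioo_subset_Iio_self (a := (0 : ℝ)))
        subset_rfl))).aestronglyMeasurable
        (μ := (volume : Measure E).prod (volume : Measure (ℝ × E)))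
        (MeasurableSet.univ.prod (measurableSet_Ioo.prod MeasurableSet.univ))
      have hρ : (volume : Measure E).prod μ =
          ((volume : Measure E).prod (volume : Measure (ℝ × E))).restrict
            (univ ×ˢ (Ioo 0 s ×ˢ univ)) := by
        rw [hμ, ← volume_restrict_slab_eq_prod, ← Measure.prod_restrict, Measure.restrict_univ]
      rwa [hρ]
    exact h1.mul (h2.inner (happ.comp_aestronglyMeasurable (h3.prodMk h2)))
  -- integrability on the product
  have hHi : Integrable H ((volume : Measure E).prod μ) := by
    rw [integrable_prod_iff hHm]
    refine ⟨Eventually.of_forall fun y => (hT y).1.const_mul (K y), ?_⟩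
    refine (hKi.mul_const B).mono' hHm.norm.integral_prod_right' (Eventually.of_forall fun y => ?_)
    rw [Real.norm_of_nonneg (integral_nonneg fun _ => norm_nonneg _)]
    have he : ∀ q, ‖H (y, q)‖ =
        K y * ‖⟪v q.1 q.2, fderiv ℝ (heatTest ν φ (s - q.1)) (q.2 - y) (v q.1 q.2)⟫‖ := fun q => by
      simp only [hH, norm_mul, Real.norm_of_nonneg (hK0 y)]
    calc ∫ q, ‖H (y, q)‖ ∂μ
        = K y * ∫ q, ‖⟪v q.1 q.2, fderiv ℝ (heatTest ν φ (s - q.1)) (q.2 - y) (v q.1 q.2)⟫‖ ∂μ := by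
          rw [← integral_const_mul]
          exact integral_congr_ae (Eventually.of_forall he)
      _ ≤ K y * B := mul_le_mul_of_nonneg_left (hT y).2 (hK0 y)
  -- the `y`-integral at fixed `(τ, x)`
  have hker : ∀ q : ℝ × E,
      Integrable (fun y => K y • fderiv ℝ (heatTest ν φ (s - q.1)) (q.2 - y)) volume := fun q =>
    UnboundedOperators.integrable_heatKernel_smul_of_bound (hΨcont (s - q.1)) (hΨbd (s - q.1))
      ha q.2
  have hinner : ∀ q : ℝ × E, ∫ y, H (y, q) = ⟪v q.1 q.2,
      UnboundedOperators.heatExtension (fderiv ℝ (heatTest ν φ (s - q.1))) a q.2 (v q.1 q.2)⟫ := by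
    intro q
    have h1 : ∀ y, H (y, q) =
        ⟪v q.1 q.2, (K y • fderiv ℝ (heatTest ν φ (s - q.1)) (q.2 - y)) (v q.1 q.2)⟫ := fun y => by
      simp only [hH, smul_apply, real_inner_smul_right]
    simp_rw [h1]
    rw [integral_inner ((hker q).apply_continuousLinearMap (v q.1 q.2)) (v q.1 q.2),
      ← ContinuousLinearMap.integral_apply (hker q) (v q.1 q.2),
      UnboundedOperators.heatExtension_apply]
  -- the left-hand side as an iterated integral of `H`
  have hlhs : ∀ y, K y *
      (∫ τ in 0..s, ∫ x, ⟪v τ x, fderiv ℝ (heatTest ν φ (s - τ)) (x - y) (v τ x)⟫) =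
        ∫ q, H (y, q) ∂μ := by
    intro y
    have h1 : ∫ q, H (y, q) ∂μ =
        K y * ∫ q, ⟪v q.1 q.2, fderiv ℝ (heatTest ν φ (s - q.1)) (q.2 - y) (v q.1 q.2)⟫ ∂μ := by
      simp only [hH]
      exact integral_const_mul _ _
    rw [h1, hμ, integral_prod _ (hT y).1, intervalIntegral.integral_of_le hs,
      integral_Ioc_eq_integral_Ioo]
  have hL : Integrable (fun q : ℝ × E => ⟪v q.1 q.2,
      UnboundedOperators.heatExtension (fderiv ℝ (heatTest ν φ (s - q.1))) a q.2 (v q.1 q.2)⟫) μ :=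
    hHi.integral_prod_right.congr (Eventually.of_forall hinner)
  refine ⟨hHi.integral_prod_left.congr (Eventually.of_forall fun y => (hlhs y).symm), ?_⟩
  calc ∫ y, K y * (∫ τ in 0..s, ∫ x, ⟪v τ x, fderiv ℝ (heatTest ν φ (s - τ)) (x - y) (v τ x)⟫)
      = ∫ y, ∫ q, H (y, q) ∂μ := integral_congr_ae (Eventually.of_forall hlhs)
    _ = ∫ q, (∫ y, H (y, q)) ∂μ := integral_integral_swap (f := fun y q => H (y, q)) hHi
    _ = ∫ q, ⟪v q.1 q.2, UnboundedOperators.heatExtension (fderiv ℝ (heatTest ν φ (s - q.1))) a q.2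
          (v q.1 q.2)⟫ ∂μ := integral_congr_ae (Eventually.of_forall hinner)
    _ = ∫ τ in 0..s, ∫ x, ⟪v τ x,
          UnboundedOperators.heatExtension (fderiv ℝ (heatTest ν φ (s - τ))) a x (v τ x)⟫ := by
        rw [hμ, integral_prod _ (by rwa [hμ] at hL), intervalIntegral.integral_of_le hs,
          integral_Ioc_eq_integral_Ioo]

end Transport

/-! ### The two-time identity -/

section Restart

variable {ν T : ℝ} {u₀ : E → E} {v : ℝ → E → E}

/-- **The two-time (restart) identity for `C([0,T); L³)` mild solutions**, any dimension
(Fabes–Jones–Rivière 1972, Thm. 2.1; Lemarié-Rieusset 2016, Thm. 6.1 with Prop. 6.5: in the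
classes used, very weak solutions satisfy the Duhamel formula from every intermediate time).
Let `ν > 0`, `u₀ ∈ L³`, and `v` an unforced mild solution on `[0, T)` from `u₀` in the duality
form, with `v ∈ C([0,T); L³)` and `v` jointly measurable on `(0,T) × E`. Then
`Fluid.IsMildNSSolutionBetween ν 0 v s t` for all `0 ≤ s ≤ t < T`. Proof: average the identity at
time `s` for the translated tests `φ(· - y)` against the heat kernel at time `ν(t - s)`
(`integral_heatKernel_mul_integral_inner_comp_sub`, `integral_heatKernel_mul_transport`), use the
semigroup law (`heatExtension_heatTest_eq`) and subtract from the identity at time `t`. [cite: FabesJonesRiviere1972, Thm. 2.1] -/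
theorem IsMildNSSolutionOn.isMildNSSolutionBetween_of_continuousInLpOn (hν : 0 < ν)
    (hu₀ : MemLp u₀ 3 volume) (hv : IsMildNSSolutionOn (Ico 0 T) ν 0 u₀ v)
    (hvc : ContinuousInLpOn (Ico 0 T) 3 v)
    (hmeas : AEStronglyMeasurable (uncurry v)
      ((volume : Measure (ℝ × E)).restrict (Ioo 0 T ×ˢ univ)))
    {s t : ℝ} (hs : 0 ≤ s) (hst : s ≤ t) (ht : t < T) :
    IsMildNSSolutionBetween ν 0 v s t := by
  rcases hst.eq_or_lt with rfl | hst'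
  · exact IsMildNSSolutionBetween.refl ν 0 v s
  intro φ hφ hdiv
  simp only [Pi.zero_apply, inner_zero_left, integral_zero, intervalIntegral.integral_zero,
    add_zero, convect_apply]
  have hφ1 : ContDiff ℝ 1 φ := hφ.contDiff.of_le (by exact_mod_cast le_top)
  have hφc : HasCompactSupport φ := hφ.hasCompactSupport
  have h3 : (1 : ℝ≥0∞) ≤ 3 := by norm_num
  haveI hHC : (3 : ℝ≥0∞).HolderConjugate (ENNReal.conjExponent 3) := .conjExponent (by norm_num)
  have hq1 : 1 ≤ ENNReal.conjExponent 3 := ENNReal.HolderConjugate.one_le (ENNReal.conjExponent 3) 3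
  have htT : t ∈ Ico 0 T := ⟨hs.trans hst, ht⟩
  have hsT : s ∈ Ico 0 T := ⟨hs, hst.trans_lt ht⟩
  have hts : 0 < t - s := sub_pos.2 hst'
  -- uniform `L³` bound on `[0, t]`
  have hKS : Icc 0 t ⊆ Ico 0 T := fun τ hτ => ⟨hτ.1, hτ.2.trans_lt ht⟩
  obtain ⟨M, hM⟩ := hvc.exists_forall_eLpNorm_le h3 isCompact_Icc hKS
  have hv3 : ∀ τ ∈ Icc 0 t, MemLp (v τ) 3 (volume : Measure E) ∧ eLpNorm (v τ) 3 volume ≤ M :=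
    fun τ hτ => ⟨hvc.1 τ (hKS hτ), hM τ hτ⟩
  have hv3s : ∀ τ ∈ Icc 0 s, MemLp (v τ) 3 (volume : Measure E) ∧ eLpNorm (v τ) 3 volume ≤ M :=
    fun τ hτ => hv3 τ ⟨hτ.1, hτ.2.trans hst⟩
  -- the nonlinear density is interval integrable on `[0, t]`
  have hN : IntervalIntegrable
      (fun τ => ∫ x, ⟪v τ x, fderiv ℝ (heatTest ν φ (t - τ)) x (v τ x)⟫) volume 0 t :=
    intervalIntegrable_transportPairing hν hφ1 hφc htT.1 ht.le hmeas hmeas ENNReal.coe_lt_top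
      ENNReal.coe_lt_top hv3 hv3
  -- the identity at time `t`
  have et := hv.2 t htT φ hφ hdiv
  simp only [Pi.zero_apply, inner_zero_left, integral_zero, intervalIntegral.integral_zero,
    add_zero, convect_apply] at et
  -- the identity at time `s`, for every translated test
  have ey : ∀ y : E, ∫ x, ⟪v s x, φ (x - y)⟫ = (∫ x, ⟪u₀ x, heatTest ν φ s (x - y)⟫) +
      ∫ τ in 0..s, ∫ x, ⟪v τ x, fderiv ℝ (heatTest ν φ (s - τ)) (x - y) (v τ x)⟫ := by
    intro y
    have h := hv.2 s hsT (fun x => φ (x + -y)) (hφ.comp_add_right_top (-y))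
      (hdiv.comp_add_right (-y))
    simp only [Pi.zero_apply, inner_zero_left, integral_zero, intervalIntegral.integral_zero,
      add_zero, convect_apply] at h
    have e1 : ∀ σ, heatTest ν (fun x => φ (x + -y)) σ = fun z => heatTest ν φ σ (z - y) :=
      fun σ => by
        funext z
        rw [heatTest_comp_add_right, ← sub_eq_add_neg]
    have e2 : ∀ σ z, fderiv ℝ (heatTest ν (fun x => φ (x + -y)) σ) z =
        fderiv ℝ (heatTest ν φ σ) (z - y) := fun σ z => by
      have : heatTest ν (fun x => φ (x + -y)) σ = fun z => heatTest ν φ σ (z + -y) :=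
        funext fun z => heatTest_comp_add_right ν φ (-y) σ z
      rw [this, fderiv_comp_add_right, ← sub_eq_add_neg]
    simp only [e2] at h
    simp only [e1] at h
    simp only [← sub_eq_add_neg] at h
    exact h
  -- averaging against the heat kernel at time `a = ν (t - s)`
  have ha : 0 < ν * (t - s) := mul_pos hν hts
  have hφq : MemLp φ (ENNReal.conjExponent 3) volume :=
    hφ.contDiff.continuous.memLp_of_hasCompactSupport hφc
  have hψq : MemLp (heatTest ν φ s) (ENNReal.conjExponent 3) volume :=
    memLp_heatFlow_holds hφq hq1 (mul_nonneg hν.le hs)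
  have hDφ : MemLp (fderiv ℝ φ) 3 (volume : Measure E) :=
    (hφ1.continuous_fderiv one_ne_zero).memLp_of_hasCompactSupport (hφc.fderiv ℝ)
  obtain ⟨-, I1⟩ := integral_heatKernel_mul_integral_inner_comp_sub (hv3 s ⟨hs, hst⟩).1 hφq ha
  obtain ⟨I2i, I2⟩ := integral_heatKernel_mul_integral_inner_comp_sub hu₀ hψq ha
  obtain ⟨I3i, I3⟩ := integral_heatKernel_mul_transport hν hφ1 hφc hs (hst.trans ht.le) hmeas
    hv3s ha
  have key : ∫ x, ⟪v s x, heatTest ν φ (t - s) x⟫ = (∫ x, ⟪u₀ x, heatTest ν φ t x⟫) +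
      ∫ τ in 0..s, ∫ x, ⟪v τ x, fderiv ℝ (heatTest ν φ (t - τ)) x (v τ x)⟫ := by
    have lhs : ∫ y, UnboundedOperators.heatKernel (ν * (t - s)) y * ∫ x, ⟪v s x, φ (x - y)⟫ =
        ∫ x, ⟪v s x, heatTest ν φ (t - s) x⟫ := by
      rw [I1, heatTest_of_pos hν hts]
    have mid : ∫ y, UnboundedOperators.heatKernel (ν * (t - s)) y *
        ∫ x, ⟪u₀ x, heatTest ν φ s (x - y)⟫ = ∫ x, ⟪u₀ x, heatTest ν φ t x⟫ := by
      rw [I2, heatExtension_heatTest_eq hφq hq1 hν hs hts, show s + (t - s) = t by ring]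
    have rhs : ∫ y, UnboundedOperators.heatKernel (ν * (t - s)) y *
        (∫ τ in 0..s, ∫ x, ⟪v τ x, fderiv ℝ (heatTest ν φ (s - τ)) (x - y) (v τ x)⟫) =
          ∫ τ in 0..s, ∫ x, ⟪v τ x, fderiv ℝ (heatTest ν φ (t - τ)) x (v τ x)⟫ := by
      rw [I3]
      refine intervalIntegral.integral_congr fun τ hτ => ?_
      rw [uIcc_of_le hs] at hτ
      have hK : UnboundedOperators.heatExtension (fderiv ℝ (heatTest ν φ (s - τ))) (ν * (t - s)) =
          fderiv ℝ (heatTest ν φ (t - τ)) := by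
        rw [fderiv_heatTest_eq_heatTest_fderiv hφ1 hφc ν (s - τ),
          heatExtension_heatTest_eq hDφ h3 hν (sub_nonneg.2 hτ.2) hts,
          fderiv_heatTest_eq_heatTest_fderiv hφ1 hφc ν (t - τ), show s - τ + (t - s) = t - τ by ring]
      simp only [hK]
    calc ∫ x, ⟪v s x, heatTest ν φ (t - s) x⟫
        = ∫ y, UnboundedOperators.heatKernel (ν * (t - s)) y * ∫ x, ⟪v s x, φ (x - y)⟫ := lhs.symm
      _ = ∫ y, ((UnboundedOperators.heatKernel (ν * (t - s)) y *
              ∫ x, ⟪u₀ x, heatTest ν φ s (x - y)⟫) +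
            UnboundedOperators.heatKernel (ν * (t - s)) y *
              ∫ τ in 0..s, ∫ x, ⟪v τ x, fderiv ℝ (heatTest ν φ (s - τ)) (x - y) (v τ x)⟫) := by
          refine integral_congr_ae (Eventually.of_forall fun y => ?_)
          beta_reduce
          rw [ey y, mul_add]
      _ = (∫ y, UnboundedOperators.heatKernel (ν * (t - s)) y *
              ∫ x, ⟪u₀ x, heatTest ν φ s (x - y)⟫) +
            ∫ y, UnboundedOperators.heatKernel (ν * (t - s)) y *
              ∫ τ in 0..s, ∫ x, ⟪v τ x, fderiv ℝ (heatTest ν φ (s - τ)) (x - y) (v τ x)⟫ :=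
          integral_add I2i I3i
      _ = _ := by rw [mid, rhs]
  -- conclusion: `∫₀ᵗ = ∫₀ˢ + ∫ₛᵗ`
  rw [et, key, add_assoc, intervalIntegral.integral_add_adjacent_intervals
    (hN.mono_set (uIcc_subset_uIcc_left (mem_uIcc_of_le hs hst)))
    (hN.mono_set (uIcc_subset_uIcc_right (mem_uIcc_of_le hs hst)))]

end Restart

end Literature.Analysis.FluidPDE

/-! ### `ℝ³`: the discharge -/

namespace Literature.Analysis.FluidPDE

/-- **`mild_L3_restart`, PROVED** (Fabes–Jones–Rivière 1972, Thm. 2.1; Lemarié-Rieusset 2016,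
Thm. 6.1 and Prop. 6.5, PDF pp. 134–136 of doi:10.1201/b19556): a mild solution in
`C([0,T); L³(ℝ³))` of the unforced Navier–Stokes equations in the duality form satisfies the
two-time identity `Fluid.IsMildNSSolutionBetween ν 0 v s t` for all `0 ≤ s ≤ t < T` — the
general theorem `IsMildNSSolutionOn.isMildNSSolutionBetween_of_continuousInLpOn` on `ℝ³`. [cite: FabesJonesRiviere1972, Thm. 2.1] -/
theorem mild_L3_restart_holds : mild_L3_restart :=
  fun hν _hT _ _ hu₀ hv hvc hmeas _ _ hs hst ht =>
    hv.isMildNSSolutionBetween_of_continuousInLpOn hν hu₀ hvc hmeas hs hst ht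

end Literature.Analysis.FluidPDE
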